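import Summits.QuantumFields.YangMills.Theorems.ColdStartUniversalityLatticeLangevinLiebRobinsonClusteringWilsonLoops
import HarnessLib

/-!
# Route `ColdStartUniversality` (fixed-cut-off SZZ dynamics; LIEB–ROBINSON / LOCALITY package, file 22):
# correlation freezing with a GENERAL LIGHT-CONE BASE `K ≥ 1` — sharper constants for the clustering theorems

Helper file (seat `ym-line-csu-p1`, g31; `--supports stmt-QuantumFields-24809`).  Files 11/15 use the exponential torus weight `108^D` (needed there for
the volume-free tail sums of the light cone); the clustering argument (files 15–17) never sums over the light cone and works with ANY admissible base
`K ≥ 1` in `transitionKernel_liebRobinson` (g30), trading a slower cone speed `λ_K = |β'|(4+4√2+12K)` against a weaker spatial decay `K^(−D)`.  For the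
decay rate of correlations `m_K = ρ·log K/(λ_K+ρ)` this is a large gain: at `|β'| = 1/24`, `m_108 ≈ 0.043` but `m_5 ≈ 0.24` per lattice spacing.
* ★★ `transitionKernel_liebRobinson_profile_base` — `κ_t` propagates link-Lipschitz profiles: constant at `e₀` `≤ e^(λ_K t)·Σ_e ℓ_e K^(−D(e,e₀))`;
* ★★★ `abs_integral_generator_mul_transition_le_base` — `|∫(𝓛g)·κ_r F dμ| ≤ 8e^(λ_K r)·Σ_e Σ_e' ℓ^G_e ℓ^F_e' K^(−D(e',e))`;
* ★★★ `wilson_integral_mul_transition_sub_le_base` — `|∫F·κ_T G dμ − ∫FG dμ| ≤ 8T e^(λ_K T)·Σ_e Σ_e' ℓ^G_e ℓ^F_e' K^(−D(e',e))`, EVERY coupling, every `L`.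
THEOREMS ONLY, no definition, no sorry; [folklore].  HONEST FRAMING: fixed cut-off; every coupling here; constants only — nothing `K`-uniform (in the
route's cut-off sense) and nothing about the continuum; `UniformColdStartMixing` (24809) is NOT restated; no crux, rung or summit statement is proved;
the Yang–Mills mass gap is NOT proved.
-/

set_option autoImplicit false

noncomputable section

namespace Summit.QuantumFields.YangMills.Theorems.ColdStartUniversality.LiebRobinson

open MeasureTheory ProbabilityTheory Matrix Complex Finset Filter Set Metric intervalIntegral
open scoped ComplexConjugate BigOperators Matrix NNReal ENNReal Topology
open Literature.Probability.Process Literature.MathematicalPhysics.QuantumFieldTheory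
open Literature.MathematicalPhysics.QuantumFieldTheory.Balaban1983to89
open Literature.MathematicalPhysics.QuantumLattice (fundamentalRep fundamentalLatticeRep continuous_fundamentalRep fundamentalRep_apply)

variable {L : ℕ} [NeZero L]

/-! ## Correlation freezing with base `K` -/


/-- ★★ **Propagation of link-Lipschitz profiles with a general exponential weight base `K ≥ 1`** (every coupling, every volume): if `F` is
continuous and `ℓ_e`-Lipschitz in each link, then for all starts `y, y'` differing only at `e₀`:
`|κ_t F(y) − κ_t F(y')| ≤ e^(|β'|(4+4√2+12K)t)·(Σ_e ℓ_e K^(−D(e,e₀)))·‖y_(e₀) − y'_(e₀)‖_F` (`transitionKernel_liebRobinson` with the admissible weight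
`K^(D(·,e₀))`; the case `K = 108` is `transitionKernel_linkLipschitz_profile`).  Smaller `K` = slower light cone. [folklore] -/
theorem transitionKernel_liebRobinson_profile_base (L : ℕ) [NeZero L] (β' : ℝ) (K : ℝ) (hK : 1 ≤ K)
    (κ : ℝ≥0 → Kernel (GaugeConfig 3 L (Matrix.specialUnitaryGroup (Fin 2) ℂ))
      (GaugeConfig 3 L (Matrix.specialUnitaryGroup (Fin 2) ℂ))) [∀ t, IsMarkovKernel (κ t)]
    (hreal : ∀ (t : ℝ≥0) (x : GaugeConfig 3 L (Matrix.specialUnitaryGroup (Fin 2) ℂ))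
        (Ω : Type) [MeasurableSpace Ω] (P : Measure Ω) [IsProbabilityMeasure P]
        (W : ℝ≥0 → Ω → (Edge 3 L × NoiseIdx 2 → ℝ)) (hW : IsFlatBrownian W P)
        (U : ℝ≥0 → Ω → GaugeConfig 3 L (Matrix.specialUnitaryGroup (Fin 2) ℂ)),
        (∀ ω, U 0 ω = x) →
        (latticeLangevinDynamics (fundamentalLatticeRep 2) β').IsSolution (fundamentalRep (Fin 2))
          hW.natFiltration P W U →
        κ t x = P.map (U t))
    {F : (GaugeConfig 3 L (Matrix.specialUnitaryGroup (Fin 2) ℂ)) → ℝ} (hFc : Continuous F) {ℓ : Edge 3 L → ℝ} (hℓ : ∀ e, 0 ≤ ℓ e)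
    (hF : ∀ (e : Edge 3 L) (y y' : (GaugeConfig 3 L (Matrix.specialUnitaryGroup (Fin 2) ℂ))), (∀ f, f ≠ e → y f = y' f) →
      |F y - F y'| ≤ ℓ e * frobNorm ((y e : Matrix (Fin 2) (Fin 2) ℂ) - (y' e : Matrix (Fin 2) (Fin 2) ℂ)))
    (t : ℝ≥0) (e₀ : Edge 3 L) (y y' : (GaugeConfig 3 L (Matrix.specialUnitaryGroup (Fin 2) ℂ))) (hyy' : ∀ e, e ≠ e₀ → y e = y' e) :
    |∫ z, F z ∂(κ t y) - ∫ z, F z ∂(κ t y')| ≤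
      Real.exp ((|β'| * (4 + 4 * Real.sqrt 2 + 12 * K)) * (t : ℝ)) * (∑ e : Edge 3 L, ℓ e * (K⁻¹) ^ (Finset.univ.sup fun i : Fin 3 => ((e.1 i - e₀.1 i).valMinAbs).natAbs)) *
        frobNorm ((y e₀ : Matrix (Fin 2) (Fin 2) ℂ) - (y' e₀ : Matrix (Fin 2) (Fin 2) ℂ)) := by
  classical
  have hK0 : (0 : ℝ) < K := by linarith
  set w : Edge 3 L → ℝ := fun e => K ^ (Finset.univ.sup fun i : Fin 3 => ((e.1 i - e₀.1 i).valMinAbs).natAbs) with hw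
  have hwpos : ∀ e, 0 < w e := fun e => by rw [hw]; exact pow_pos hK0 _
  have hwadm := weight_pow_torusDist_admissible (L := L) e₀.1 (K := K) hK
  have hLR := transitionKernel_liebRobinson L β' κ hreal w hwpos K hK0.le (fun e j hj => hwadm e j hj) hFc ℓ hℓ hF t y y'
  have hsum : ∑ f' : Edge 3 L, w f' * frobNorm ((y f' : Matrix (Fin 2) (Fin 2) ℂ) - (y' f' : Matrix (Fin 2) (Fin 2) ℂ)) = frobNorm ((y e₀ : Matrix (Fin 2) (Fin 2) ℂ) - (y' e₀ : Matrix (Fin 2) (Fin 2) ℂ)) := by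
    rw [Finset.sum_eq_single e₀]
    · have hw0 : w e₀ = 1 := by rw [hw]; simp only [torusDist_self, pow_zero]
      rw [hw0, one_mul]
    · intro f' _ hf'
      rw [hyy' f' hf', sub_self, frobNorm_zero, mul_zero]
    · intro h; exact absurd (Finset.mem_univ _) h
  have hratio : ∑ e : Edge 3 L, ℓ e / w e = ∑ e : Edge 3 L, ℓ e * (K⁻¹) ^ (Finset.univ.sup fun i : Fin 3 => ((e.1 i - e₀.1 i).valMinAbs).natAbs) := by
    refine Finset.sum_congr rfl fun e _ => ?_
    rw [hw, inv_pow, div_eq_mul_inv]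
  rw [hsum, hratio] at hLR
  exact hLR

/-- ★★★ **The Dirichlet energy between `g` and `κ_r F` is exponentially small before the light cone of `F` reaches the links of `g`.**
For every coupling `β'`, torus size `L`, realising Markov kernel family `κ`, `C³` `f` whose pull-back `F = f∘coords` has a link-Lipschitz
profile `ℓ^F ≥ 0`, `C³` compactly supported `g` with profile `ℓ^G ≥ 0`, and every lattice time `r`:
`|∫ (𝓛g)·(κ_r F) dμ_(β')| ≤ 8·e^(λr)·Σ_e Σ_e' ℓ^G_e·ℓ^F_e'·K^(−D(e',e))`, `λ = |β'|(4+4√2+12K)`, `D` = cyclic sup-distance of base sites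
(`transitionKernel_preserves_dynkinClass` for a `C³_c` representative of `κ_r F`, its Lieb–Robinson profile `transitionKernel_linkLipschitz_profile`,
and the locality of the energy `abs_integral_mul_generator_le_of_linkLipschitz`). [folklore] -/
theorem abs_integral_generator_mul_transition_le_base (L : ℕ) [NeZero L] (β' : ℝ) (K : ℝ) (hK : 1 ≤ K)
    (κ : ℝ≥0 → Kernel (GaugeConfig 3 L (Matrix.specialUnitaryGroup (Fin 2) ℂ))
      (GaugeConfig 3 L (Matrix.specialUnitaryGroup (Fin 2) ℂ))) [∀ t, IsMarkovKernel (κ t)]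
    (hreal : ∀ (t : ℝ≥0) (x : GaugeConfig 3 L (Matrix.specialUnitaryGroup (Fin 2) ℂ))
        (Ω : Type) [MeasurableSpace Ω] (P : Measure Ω) [IsProbabilityMeasure P]
        (W : ℝ≥0 → Ω → (Edge 3 L × NoiseIdx 2 → ℝ)) (hW : IsFlatBrownian W P)
        (U : ℝ≥0 → Ω → GaugeConfig 3 L (Matrix.specialUnitaryGroup (Fin 2) ℂ)),
        (∀ ω, U 0 ω = x) →
        (latticeLangevinDynamics (fundamentalLatticeRep 2) β').IsSolution (fundamentalRep (Fin 2))
          hW.natFiltration P W U →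
        κ t x = P.map (U t))
    {f : (Edge 3 L × Fin 2 × Fin 2 × Bool → ℝ) → ℝ} (hf : ContDiff ℝ 3 f) {ℓF : Edge 3 L → ℝ} (hℓF : ∀ e, 0 ≤ ℓF e)
    {g : (Edge 3 L × Fin 2 × Fin 2 × Bool → ℝ) → ℝ} (hg : ContDiff ℝ 3 g) (hgc : HasCompactSupport g) {ℓG : Edge 3 L → ℝ} (hℓG : ∀ e, 0 ≤ ℓG e)
    (r : ℝ≥0) :
    let coords : GaugeConfig 3 L (Matrix.specialUnitaryGroup (Fin 2) ℂ) → (Edge 3 L × Fin 2 × Fin 2 × Bool → ℝ) :=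
      fun V q => (fun z : ℂ => if q.2.2.2 then z.im else z.re)
        ((fundamentalRep (Fin 2) (V q.1) : Matrix (Fin 2) (Fin 2) ℂ) q.2.1 q.2.2.1)
    let gen : GaugeConfig 3 L (Matrix.specialUnitaryGroup (Fin 2) ℂ) → ℝ := fun V =>
      (∑ i : Edge 3 L × Fin 2 × Fin 2 × Bool, fderiv ℝ g (coords V) (Pi.single i 1) *
          (fun z : ℂ => if i.2.2.2 then z.im else z.re)
            ((latticeLangevinDynamics (fundamentalLatticeRep 2) β').drift
              (matrixConfig (fundamentalRep (Fin 2)) V) i.1 i.2.1 i.2.2.1) +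
      1 / 2 * ∑ i : Edge 3 L × Fin 2 × Fin 2 × Bool, ∑ j : Edge 3 L × Fin 2 × Fin 2 × Bool,
        fderiv ℝ (fun z => fderiv ℝ g z (Pi.single i 1)) (coords V) (Pi.single j 1) *
          ∑ n : Edge 3 L × NoiseIdx 2,
            (if n.1 = i.1 then (fun z : ℂ => if i.2.2.2 then z.im else z.re)
              ((latticeLangevinDynamics (fundamentalLatticeRep 2) β').noise
                (matrixConfig (fundamentalRep (Fin 2)) V) i.1 n.2 i.2.1 i.2.2.1) else 0) *
            (if n.1 = j.1 then (fun z : ℂ => if j.2.2.2 then z.im else z.re)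
              ((latticeLangevinDynamics (fundamentalLatticeRep 2) β').noise
                (matrixConfig (fundamentalRep (Fin 2)) V) j.1 n.2 j.2.1 j.2.2.1) else 0))
    (∀ (e : Edge 3 L) (y y' : (GaugeConfig 3 L (Matrix.specialUnitaryGroup (Fin 2) ℂ))), (∀ f', f' ≠ e → y f' = y' f') →
      |f (coords y) - f (coords y')| ≤ ℓF e * frobNorm ((y e : Matrix (Fin 2) (Fin 2) ℂ) - (y' e : Matrix (Fin 2) (Fin 2) ℂ))) →
    (∀ (e : Edge 3 L) (y y' : (GaugeConfig 3 L (Matrix.specialUnitaryGroup (Fin 2) ℂ))), (∀ f', f' ≠ e → y f' = y' f') →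
      |g (coords y) - g (coords y')| ≤ ℓG e * frobNorm ((y e : Matrix (Fin 2) (Fin 2) ℂ) - (y' e : Matrix (Fin 2) (Fin 2) ℂ))) →
    |∫ x, gen x * (∫ y, f (coords y) ∂(κ r x)) ∂(wilsonMeasure (d := 3) (L := L) (fundamentalRep (Fin 2)) β')| ≤
      8 * Real.exp ((|β'| * (4 + 4 * Real.sqrt 2 + 12 * K)) * (r : ℝ)) * ∑ e : Edge 3 L, ∑ e' : Edge 3 L, ℓG e * ℓF e' * (K⁻¹) ^ (Finset.univ.sup fun i : Fin 3 => ((e'.1 i - e.1 i).valMinAbs).natAbs) := by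
  intro coords gen hLf hLg
  classical
  have hK0 : (0 : ℝ) < K := by linarith
  have hco : Continuous coords := continuous_coords (L := L)
  have hFc : Continuous fun V => f (coords V) := hf.continuous.comp hco
  -- a `C³_c` representative of `κ_r F`
  obtain ⟨a, ha, hac, hrep⟩ := transitionKernel_preserves_dynkinClass L β' κ hreal r hf
  -- its Lieb–Robinson link-Lipschitz profile
  set m : Edge 3 L → ℝ := fun e => Real.exp ((|β'| * (4 + 4 * Real.sqrt 2 + 12 * K)) * (r : ℝ)) *
    ∑ e' : Edge 3 L, ℓF e' * (K⁻¹) ^ (Finset.univ.sup fun i : Fin 3 => ((e'.1 i - e.1 i).valMinAbs).natAbs) with hm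
  have hm0 : ∀ e, 0 ≤ m e := fun e => by
    rw [hm]; exact mul_nonneg (Real.exp_pos _).le (Finset.sum_nonneg fun e' _ => mul_nonneg (hℓF e') (pow_nonneg (inv_nonneg.2 hK0.le) _))
  have hLa : ∀ (e : Edge 3 L) (y y' : (GaugeConfig 3 L (Matrix.specialUnitaryGroup (Fin 2) ℂ))), (∀ f', f' ≠ e → y f' = y' f') →
      |a (coords y) - a (coords y')| ≤ m e * frobNorm ((y e : Matrix (Fin 2) (Fin 2) ℂ) - (y' e : Matrix (Fin 2) (Fin 2) ℂ)) := by
    intro e y y' hyy'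
    have h := transitionKernel_liebRobinson_profile_base L β' K hK κ hreal hFc hℓF hLf r e y y' hyy'
    rw [hrep y, hrep y'] at h
    simpa only [hm] using h
  have hswap : ∫ x, gen x * (∫ y, f (coords y) ∂(κ r x)) ∂(wilsonMeasure (d := 3) (L := L) (fundamentalRep (Fin 2)) β') =
      ∫ x, a (coords x) * gen x ∂(wilsonMeasure (d := 3) (L := L) (fundamentalRep (Fin 2)) β') := by
    refine integral_congr_ae (Eventually.of_forall fun x => ?_)
    show gen x * (∫ y, f (coords y) ∂(κ r x)) = a (coords x) * gen x
    rw [hrep x, mul_comm]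
  rw [hswap]
  have key := abs_integral_mul_generator_le_of_linkLipschitz L β' ha hac hg hgc hm0 hℓG hLa hLg
  refine key.trans (le_of_eq ?_)
  simp only [hm]
  rw [Finset.mul_sum, Finset.mul_sum]
  refine Finset.sum_congr rfl fun e _ => ?_
  rw [Finset.mul_sum, Finset.mul_sum, Finset.sum_mul, Finset.mul_sum]
  refine Finset.sum_congr rfl fun e' _ => ?_
  ring

/-- ★★★ **Equilibrium time-correlations are frozen outside the light cone.**  For every coupling `β'`, torus size `L`, realising
Markov kernel family `κ`, `C³` `f` (pull-back profile `ℓ^F ≥ 0`), `C³` compactly supported `g` (profile `ℓ^G ≥ 0`) and every `T ≥ 0`: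
`|∫ F·(κ_T G) dμ_(β') − ∫ F·G dμ_(β')| ≤ 8·T·e^(λT)·Σ_e Σ_e' ℓ^G_e·ℓ^F_e'·K^(−D(e',e))`, `λ = |β'|(4+4√2+12K)`.
When the profiles are supported in sets of links at mutual sup-distance `> R` the double sum is `≤ K^(−(R+1))·(Σℓ^F)(Σℓ^G)`: the
correlation at time `T` differs from the static one by `≲ T·e^(λT − (R+1) log K)`, uniformly in the volume — the Lieb–Robinson half of
exponential clustering (`…LiebRobinsonClustering`). [folklore] -/
theorem wilson_integral_mul_transition_sub_le_base (L : ℕ) [NeZero L] (β' : ℝ) (K : ℝ) (hK : 1 ≤ K)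
    (κ : ℝ≥0 → Kernel (GaugeConfig 3 L (Matrix.specialUnitaryGroup (Fin 2) ℂ))
      (GaugeConfig 3 L (Matrix.specialUnitaryGroup (Fin 2) ℂ))) [∀ t, IsMarkovKernel (κ t)]
    (hreal : ∀ (t : ℝ≥0) (x : GaugeConfig 3 L (Matrix.specialUnitaryGroup (Fin 2) ℂ))
        (Ω : Type) [MeasurableSpace Ω] (P : Measure Ω) [IsProbabilityMeasure P]
        (W : ℝ≥0 → Ω → (Edge 3 L × NoiseIdx 2 → ℝ)) (hW : IsFlatBrownian W P)
        (U : ℝ≥0 → Ω → GaugeConfig 3 L (Matrix.specialUnitaryGroup (Fin 2) ℂ)),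
        (∀ ω, U 0 ω = x) →
        (latticeLangevinDynamics (fundamentalLatticeRep 2) β').IsSolution (fundamentalRep (Fin 2))
          hW.natFiltration P W U →
        κ t x = P.map (U t))
    {f : (Edge 3 L × Fin 2 × Fin 2 × Bool → ℝ) → ℝ} (hf : ContDiff ℝ 3 f) {ℓF : Edge 3 L → ℝ} (hℓF : ∀ e, 0 ≤ ℓF e)
    {g : (Edge 3 L × Fin 2 × Fin 2 × Bool → ℝ) → ℝ} (hg : ContDiff ℝ 3 g) (hgc : HasCompactSupport g) {ℓG : Edge 3 L → ℝ} (hℓG : ∀ e, 0 ≤ ℓG e)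
    {T : ℝ} (hT : 0 ≤ T) :
    let coords : GaugeConfig 3 L (Matrix.specialUnitaryGroup (Fin 2) ℂ) → (Edge 3 L × Fin 2 × Fin 2 × Bool → ℝ) :=
      fun V q => (fun z : ℂ => if q.2.2.2 then z.im else z.re)
        ((fundamentalRep (Fin 2) (V q.1) : Matrix (Fin 2) (Fin 2) ℂ) q.2.1 q.2.2.1)
    (∀ (e : Edge 3 L) (y y' : (GaugeConfig 3 L (Matrix.specialUnitaryGroup (Fin 2) ℂ))), (∀ f', f' ≠ e → y f' = y' f') →
      |f (coords y) - f (coords y')| ≤ ℓF e * frobNorm ((y e : Matrix (Fin 2) (Fin 2) ℂ) - (y' e : Matrix (Fin 2) (Fin 2) ℂ))) →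
    (∀ (e : Edge 3 L) (y y' : (GaugeConfig 3 L (Matrix.specialUnitaryGroup (Fin 2) ℂ))), (∀ f', f' ≠ e → y f' = y' f') →
      |g (coords y) - g (coords y')| ≤ ℓG e * frobNorm ((y e : Matrix (Fin 2) (Fin 2) ℂ) - (y' e : Matrix (Fin 2) (Fin 2) ℂ))) →
    |(∫ x, f (coords x) * (∫ y, g (coords y) ∂(κ T.toNNReal x)) ∂(wilsonMeasure (d := 3) (L := L) (fundamentalRep (Fin 2)) β')) -
        ∫ x, f (coords x) * g (coords x) ∂(wilsonMeasure (d := 3) (L := L) (fundamentalRep (Fin 2)) β')| ≤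
      8 * T * Real.exp ((|β'| * (4 + 4 * Real.sqrt 2 + 12 * K)) * T) * ∑ e : Edge 3 L, ∑ e' : Edge 3 L, ℓG e * ℓF e' * (K⁻¹) ^ (Finset.univ.sup fun i : Fin 3 => ((e'.1 i - e.1 i).valMinAbs).natAbs) := by
  intro coords hLf hLg
  classical
  have hK0 : (0 : ℝ) < K := by linarith
  have hlam0 : 0 ≤ (|β'| * (4 + 4 * Real.sqrt 2 + 12 * K)) :=
    mul_nonneg (abs_nonneg _) (by have := Real.sqrt_nonneg 2; linarith)
  have hco : Continuous coords := continuous_coords (L := L)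
  have hFc : Continuous fun V => f (coords V) := hf.continuous.comp hco
  have hsymm := wilson_integral_mul_transition_sub_eq_symm L β' κ hreal hFc hg hgc hT
  rw [hsymm, ← Real.norm_eq_abs]
  set S : ℝ := ∑ e : Edge 3 L, ∑ e' : Edge 3 L, ℓG e * ℓF e' * (K⁻¹) ^ (Finset.univ.sup fun i : Fin 3 => ((e'.1 i - e.1 i).valMinAbs).natAbs) with hS
  have hS0 : 0 ≤ S := Finset.sum_nonneg fun e _ => Finset.sum_nonneg fun e' _ =>
    mul_nonneg (mul_nonneg (hℓG e) (hℓF e')) (pow_nonneg (inv_nonneg.2 hK0.le) _)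
  have h8 : (0 : ℝ) ≤ 8 := by norm_num
  refine (intervalIntegral.norm_integral_le_of_norm_le_const (C := 8 * Real.exp ((|β'| * (4 + 4 * Real.sqrt 2 + 12 * K)) * T) * S) fun r hr => ?_).trans ?_
  · rw [Set.uIoc_of_le hT] at hr
    rw [Real.norm_eq_abs]
    refine (abs_integral_generator_mul_transition_le_base L β' K hK κ hreal hf hℓF hg hgc hℓG r.toNNReal hLf hLg).trans ?_
    have hr' : ((r.toNNReal : ℝ≥0) : ℝ) = r := Real.coe_toNNReal _ hr.1.le
    rw [hr']
    have hexp : Real.exp ((|β'| * (4 + 4 * Real.sqrt 2 + 12 * K)) * r) ≤ Real.exp ((|β'| * (4 + 4 * Real.sqrt 2 + 12 * K)) * T) :=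
      Real.exp_le_exp.2 (mul_le_mul_of_nonneg_left hr.2 hlam0)
    exact mul_le_mul_of_nonneg_right (mul_le_mul_of_nonneg_left hexp h8) hS0
  · rw [sub_zero, abs_of_nonneg hT]
    exact le_of_eq (by ring)


end Summit.QuantumFields.YangMills.Theorems.ColdStartUniversality.LiebRobinson
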